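import Mathlib
import HarnessLib
import Summits.HubbardSuperconductivity.HubbardSuperconductivity.Theorems.KLProgrammeKLRegimeEngineTwoLegStepV17F2Doors
import Summits.HubbardSuperconductivity.HubbardSuperconductivity.Theorems.KLProgrammeKLRegimeEngineV8DefsG7
import Summits.HubbardSuperconductivity.HubbardSuperconductivity.Theorems.KLProgrammeKLRegimeEngineV8DefsU6
import Summits.HubbardSuperconductivity.HubbardSuperconductivity.Theorems.KLProgrammeKLRegimeTwoLegCurvatureConsts

/-!
# K3 gen 8, ENGINE child `KLRegimeEngineV17F2` (stmt-HubbardSuperconductivity-20437): the CLOSERS MODULO NAMED RESIDUALS of stubs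
# (e) `stub_twoLeg_step` and (M) `stub_twoLeg_scale0` at the LITERAL stub binders of p1's render (twin B2 27b397ccd6dfb348 / preview B6
# cbbdbfd5d729ed08 + token #7 `klEngGeo6 ↦ klEngGeo7`; plan g17 (R37) redirect)

Cell gate-hubbard-kl, seat hubbard-kl-r2d-p1 (g5).  The stub texts conclude `TwoLegStepV17F2 L M klEngGeo7 P (klEngQ6 P R) R β U μ n` (resp. `… 0`) from the
engine-flow binders `P R c hP hR hc (hc3 : c ≤ klEngC₃6 P R) μ hμ U hU (hUle : U ≤ klEngU₀6 P R c) β hβ hβc L M hL hM [n hn1 hn hreg hhist] hfr hE hJ` with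
`hJ : TwoLegReadJetBound L M klC4aJetC (klC4aJetC' P R) β U μ (klFlowFrameU … n) n` (stub 6-F's conclusion).  This file:

* §1 discharges every PACKAGE row of HOME/hubbard-kl-r2d-p1/RESIDUAL-TABLE-e-V17F.md at these binders: A2 `klC4aJetC k ≤ klEngGeo7.S k`
  (`klEngGeo7_S` rfl + c4a-1's `klC4aJetC_le_klEngGeo6_S`), `klC4aJetC' P R k ≤ (klEngQ6 P R).S' k` (c4a-1), S `0 ≤ (klEngQ6 P R).CL β n` (`klEngQ6_wf`),
  thresholds `klEngC₃6 ≤ klEngC₃3`, `klEngU₀6 ≤ klEngU₀4` (p4's DefsU6);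
* §2 **`stub_twoLeg_step_of_residuals`** — (e)'s LITERAL binders + rows B1 `hz`, B2 `hm₁'`, B3 `hfit1` (the scale-`n` shell data at `K_n`) and C1 `hcut`, C2 `hsp`
  (the two nested legs, history `histV17F2 ∧ slopes` at `klEngGeo7`) ⇒ the stub's conclusion — so (e) closes the hour its five ENGINE/VL numbers land
  (or their one-step forms via `cutLeg_/spLeg_allScales_of_step_V17F2`);
* (M)'s closer of record is p1b's `twoLegStepV17F2_zero_of_readJetBound_bareSlopes` / `twoLegStepV17F2_zero_klC4a` (…TwoLegStepV17F2ZeroCloser,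
  p530178: rows B1–B3 at the bare frame DISCHARGED from covariance moments through `twoLegStepV17F2_of_jets_slopes_nestedLegs`); here only:
* §3 **`twoLegStepV17F2_zero_iff_V17F_zero`** — at `n = 0` the comparison history is VACUOUS, so `TwoLegStepV17F2 … 0 ↔ TwoLegStepV17F … 0`; hence
  **`stub_twoLeg_scale0_of_twoLegStepV17F_zero`**: p1b's rev-1 bare-frame assembly `twoLegStepV17F_zero_bareFrame` (…TwoLegStepV17FBareFrame, p528332) at
  `G := klEngGeo7`, `Q := klEngQ6 P R` closes the rev-2 (M) stub by ONE line.

Proofs only (compositions); no definitions; nothing about the model is asserted; nothing asserts superconductivity.  [cite: BenfattoGiulianiMastropietro2006]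
(§2.4 (2.23)/(2.36)); KL STATUS 2026-08-27 plan g17 (R33)/(R37).
-/

noncomputable section

namespace Summit.HubbardSuperconductivity.HubbardSuperconductivity.Theorems.EngineV8

set_option linter.dupNamespace false -- summit = problem name (single-conjunct summit), D-0017

open Real Finset Literature.MathematicalPhysics.QuantumLattice Literature.Probability.LatticeModels
open Literature.MathematicalPhysics.QuantumLattice.FermiRG Literature.MathematicalPhysics.QuantumLattice.BandSectorCounting
open Summit.HubbardSuperconductivity.HubbardSuperconductivity.Theorems.KLProgrammeLegKernels
open Summit.HubbardSuperconductivity.HubbardSuperconductivity.Theorems.DispersionFlow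
open Summit.HubbardSuperconductivity.HubbardSuperconductivity.Theorems.PerturbedFermiCurve
open Summit.HubbardSuperconductivity.HubbardSuperconductivity.Theorems.KLRegimeSplit
open Summit.HubbardSuperconductivity.HubbardSuperconductivity.Theorems.TwoPointAssembly

/-! ## §1 The package rows at the render's binders -/

/-- Row A2 (absolute table) at the raised package: `klC4aJetC k ≤ klEngGeo7.S k` (`klEngGeo7.S = klEngGeo6.S` by `rfl`, c4a-1's table lemma). -/
theorem klC4aJetC_le_klEngGeo7_S (k : ℕ) : klC4aJetC k ≤ klEngGeo7.S k := by
  rw [klEngGeo7_S]; exact klC4aJetC_le_klEngGeo6_S k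

/-- Row S: `0 ≤ (klEngQ6 P R).CL β n` (component 8 of `klEngQ6_wf`). -/
theorem klEngQ6_CL_nonneg (P : SplitConsts) (R : RenConsts) (β : ℝ) (n : ℕ) : 0 ≤ (klEngQ6 P R).CL β n :=
  (klEngQ6_wf P R).2.2.2.2.2.2.2 β n

/-! ## §2 Stub (e) modulo its named residuals B1–B3, C1–C2 -/

/-- **STUB (e) `stub_twoLeg_step` OF 20437 MODULO ITS NAMED RESIDUALS.**  The stub's literal binders (render twin B2 + token #7), then: B1 `hz` (shell field
strength at `K_n`), B2 `hm₁'` (shell-tube gradient of the `K_n`-separated reading), B3 `hfit1` (p1b's fit), C1 `hcut` / C2 `hsp` (the two nested legs at scale `n`,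
comparison histories `histV17F2 ∧ slopes`).  Conclusion = the stub's.  (`hP`, `hM`, `hn1`, `hreg`, `hhist`, `hE` are carried for the literal shape only.) -/
theorem stub_twoLeg_step_of_residuals (P : SplitConsts) (R : RenConsts) (c : ℝ) (hP : P.WF) (hR : R.WF2) (hc : 0 < c) (hc3 : c ≤ klEngC₃6 P R)
    (μ : ℝ) (hμ : μ ∈ klWindowC) (U : ℝ) (hU : 0 < U) (hUle : U ≤ klEngU₀6 P R c) (β : ℝ) (hβ : klBetaMin ≤ β) (hβc : β ≤ Real.exp (c / U ^ 2))
    (L M : ℕ) [NeZero L] [NeZero M] (hL : klEngL₃ β U ≤ L) (hM : klEngM₃ β U L ≤ M)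
    (n : ℕ) (hn1 : 1 ≤ n) (hn : n ≤ nScales β + 1) (hreg : IsKLRegime U c (-(n : ℤ)))
    (hhist : HistP klPredsV17F2 L M klEngGeo7 P (klEngQ6 P R) R β U μ 0 n)
    (hfr : FrameOK R U (nScales β) μ (klFlowFrameU L M β U μ n))
    (hE : EngineBoundsAtV17F2 L M klEngGeo7 P (klEngQ6 P R) β U μ n)
    (hJ : TwoLegReadJetBound L M klC4aJetC (klC4aJetC' P R) β U μ (klFlowFrameU L M β U μ n) n)
    -- residual rows B1–B3 (engine numbers at the flow frame)
    (hz : ∀ k ∈ klShell L μ (klFlowFrameU L M β U μ n) n, |klFieldStrength L M β U μ (klFlowFrameU L M β U μ n) n k - 1| ≤ R.cz * |U|)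
    {m₁' : ℝ}
    (hm₁' : ∀ q : Momentum, |frameLevel μ (klFlowFrameU L M β U μ n) q| ≤ klScale klE0 n →
      ‖fderiv ℝ (evalM (symInterp L (fun p => klLocSelfEnergyRe L M β U μ (klFlowFrameU L M β U μ n) n p -
        (klFlowFrameU L M β U μ n).eval (latticeMomentum L p)))) q‖ ≤ m₁')
    (hfit1 : m₁' + 4 / 3 * R.Gfr 1 * U ^ 2 ≤ R.cz * |U| * (cDtmin (-1.2) (-0.05) / 2))
    -- residual rows C1–C2 (the two nested legs; VL / two-volume numbers)
    (hcut : ∀ (Mq : ℕ → ℕ) (L₁ M₁ M₂ : ℕ) [NeZero L₁] [NeZero M₁] [NeZero M₂], L ≤ L₁ → (klEngQ6 P R).M0 β L₁ ≤ M₁ → Mq L₁ ≤ M₁ → M₁ ≤ M₂ →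
      (∀ j < n, histV17F2 L₁ M₁ klEngGeo7 P (klEngQ6 P R) R β U μ j ∧ TwoLegSlopes L₁ M₁ R β U μ (klFlowFrameU L₁ M₁ β U μ j) j) →
      (∀ j < n, histV17F2 L₁ M₂ klEngGeo7 P (klEngQ6 P R) R β U μ j ∧ TwoLegSlopes L₁ M₂ R β U μ (klFlowFrameU L₁ M₂ β U μ j) j) →
        ∀ θ : ℝ, |klLocalPart L₁ M₁ β U μ (klFlowFrameU L₁ M₁ β U μ n) n θ -
          klLocalPart L₁ M₂ β U μ (klFlowFrameU L₁ M₂ β U μ n) n θ| ≤ (klEngQ6 P R).CL β n / 4 / L₁)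
    (hsp : ∀ (Mq : ℕ → ℕ) (L₁ L₂ M₂ : ℕ) [NeZero L₁] [NeZero L₂] [NeZero M₂], L ≤ L₁ → L₁ ∣ L₂ → (klEngQ6 P R).M0 β L₁ ≤ M₂ → Mq L₁ ≤ M₂ →
      (klEngQ6 P R).M0 β L₂ ≤ M₂ → Mq L₂ ≤ M₂ →
      (∀ j < n, histV17F2 L₁ M₂ klEngGeo7 P (klEngQ6 P R) R β U μ j ∧ TwoLegSlopes L₁ M₂ R β U μ (klFlowFrameU L₁ M₂ β U μ j) j) →
      (∀ j < n, histV17F2 L₂ M₂ klEngGeo7 P (klEngQ6 P R) R β U μ j ∧ TwoLegSlopes L₂ M₂ R β U μ (klFlowFrameU L₂ M₂ β U μ j) j) →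
        ∀ θ : ℝ, |klLocalPart L₁ M₂ β U μ (klFlowFrameU L₁ M₂ β U μ n) n θ -
          klLocalPart L₂ M₂ β U μ (klFlowFrameU L₂ M₂ β U μ n) n θ| ≤ (klEngQ6 P R).CL β n / 4 / L₁) :
    TwoLegStepV17F2 L M klEngGeo7 P (klEngQ6 P R) R β U μ n := by
  have _ := hP; have _ := hM; have _ := hn1; have _ := hreg; have _ := hhist; have _ := hE
  exact twoLegStepV17F2_of_jets_sepTubeGradient_nestedLegs_pkg klEngGeo7 (klEngQ6 P R) P hR hc (hc3.trans (klEngC₃6_le_klEngC₃3 P R)) hμ hU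
    (hUle.trans (klEngU₀6_le_klEngU₀4 P R c)) hβ hβc hL hn hfr (klEngQ6_CL_nonneg P R β n) klC4aJetC_le_klEngGeo7_S (klC4aJetC'_le_klEngQ6_S' P R)
    hJ.1 hJ.2 hz hm₁' hfit1 hcut hsp

/-! ## §3 At scale `0` the comparison history is vacuous: rev 1 ⇔ rev 2, and p1b's bare-frame assembly closes (M) -/

section Zero

variable {L M : ℕ} [NeZero L] [NeZero M]

/-- **At `n = 0` the (E3f-F) text does not read its history**: `TwoLegVolumeRateF L M hist Q β U μ 0` is the same proposition for every `hist`. -/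
theorem twoLegVolumeRateF_zero_hist_irrel (hist hist' : (L' M' : ℕ) → [NeZero L'] → [NeZero M'] → ℕ → Prop) (Q : EngConsts) (β U μ : ℝ)
    (h : TwoLegVolumeRateF L M hist Q β U μ 0) : TwoLegVolumeRateF L M hist' Q β U μ 0 := by
  intro Mq hM hMq _ L' M' _ _ hLL' hM' hMq' θ
  exact h Mq hM hMq (fun L'' M'' _ _ _ _ _ j hj => absurd hj (Nat.not_lt_zero j)) L' M' hLL' hM' hMq' θ

/-- **`TwoLegStepV17F2 … 0 ↔ TwoLegStepV17F … 0`** (the two slot texts differ only in the comparison history, vacuous at scale `0`). -/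
theorem twoLegStepV17F2_zero_iff_V17F_zero (G : GeoConsts) (P : SplitConsts) (Q : EngConsts) (R : RenConsts) (β U μ : ℝ) :
    TwoLegStepV17F2 L M G P Q R β U μ 0 ↔ TwoLegStepV17F L M G P Q R β U μ 0 :=
  ⟨fun h => ⟨h.1, h.2.1, twoLegVolumeRateF_zero_hist_irrel _ _ Q β U μ h.2.2⟩,
    fun h => ⟨h.1, h.2.1, twoLegVolumeRateF_zero_hist_irrel _ _ Q β U μ h.2.2⟩⟩

end Zero

/-- **STUB (M) OF 20437 FROM p1b's REV-1 BARE-FRAME ASSEMBLY**: the stub's literal binders + `TwoLegStepV17F L M klEngGeo7 P (klEngQ6 P R) R β U μ 0` (the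
conclusion of `twoLegStepV17F_zero_bareFrame` at `G := klEngGeo7`, `Q := klEngQ6 P R`) ⇒ the stub's conclusion. -/
theorem stub_twoLeg_scale0_of_twoLegStepV17F_zero (P : SplitConsts) (R : RenConsts) (c : ℝ) (hP : P.WF) (hR : R.WF2) (hc : 0 < c)
    (hc3 : c ≤ klEngC₃6 P R) (μ : ℝ) (hμ : μ ∈ klWindowC) (U : ℝ) (hU : 0 < U) (hUle : U ≤ klEngU₀6 P R c) (β : ℝ) (hβ : klBetaMin ≤ β)
    (hβc : β ≤ Real.exp (c / U ^ 2)) (L M : ℕ) [NeZero L] [NeZero M] (hL : klEngL₃ β U ≤ L) (hM : klEngM₃ β U L ≤ M)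
    (hfr : FrameOK R U (nScales β) μ (klFlowFrameU L M β U μ 0))
    (hE : EngineBoundsAtV17F2 L M klEngGeo7 P (klEngQ6 P R) β U μ 0)
    (hJ : TwoLegReadJetBound L M klC4aJetC (klC4aJetC' P R) β U μ (klFlowFrameU L M β U μ 0) 0)
    (h : TwoLegStepV17F L M klEngGeo7 P (klEngQ6 P R) R β U μ 0) :
    TwoLegStepV17F2 L M klEngGeo7 P (klEngQ6 P R) R β U μ 0 := by
  have _ := hP; have _ := hR; have _ := hc; have _ := hc3; have _ := hμ; have _ := hU; have _ := hUle; have _ := hβ; have _ := hβc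
  have _ := hL; have _ := hM; have _ := hfr; have _ := hE; have _ := hJ
  exact (twoLegStepV17F2_zero_iff_V17F_zero klEngGeo7 P (klEngQ6 P R) R β U μ).2 h

end Summit.HubbardSuperconductivity.HubbardSuperconductivity.Theorems.EngineV8

end
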